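import Mathlib
import HarnessLib
import Literature.MathematicalPhysics.QuantumFieldTheory.Sweep1
import Literature.MathematicalPhysics.QuantumFieldTheory.LatticeSiteRPMechanism
import Literature.MathematicalPhysics.QuantumFieldTheory.StrongCouplingClustering
import Literature.MathematicalPhysics.QuantumFieldTheory.Sweep1AreaLawProofs
import Summits.QuantumFields.YangMills.Theorems.PencilRigidityCurvatureKernelBoundSwapReflectionPositivityConeData

/-!
# `CurvatureKernelBound` — stub `SwapReflectionPositivity` (F2) of the swap-mirror programme, part 4/4

Crux `stmt-QuantumFields-11687` (`PencilRigidity.CurvatureKernelBound`), line `coupling-trichotomy`,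
REGISTERED stub `SwapReflectionPositivity`: **reflection positivity of the free-boundary Wilson lattice
gauge measure `μ_{Λ_L,β}` on the cube `Λ_L = {-L,…,L}⁴` for the diagonal site mirror `x i = x j`**
(Fröhlich–Israel–Lieb–Simon, Comm. Math. Phys. 62 (1978) 1, Thm. 2.1, reflection through sites;
Osterwalder–Seiler, Ann. Phys. 110 (1978) 440, §2): for a compact group `G`, a continuous unitary matrix
representation `ρ`, `β ≥ 0`, and a bounded measurable `F` depending on finitely many links with both
endpoints in the closed half `x j ≤ x i`, `⟨F · (F ∘ Θ)⟩_{Λ_L,β} ≥ 0`, `(ΘU)(x, k) = U(x ∘ swap i j,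
swap i j k)`.

This part applies the abstract mechanism with a shared block
(`LatticeRP.integral_mul_conj_mul_exp_nonneg_of_shared`: shared block = mirror links, positive block =
positive non-mirror links, no crossing links) on the finite product `G^E` to the cone form of the
Boltzmann weight established in parts 2–3, transfers back to `dg_∞`, and divides by `Z > 0`
(`AreaLaw.zdExpect_eq_div_integral`); the case `j < i` is `i < j` applied to `F ∘ Θ`. Parts 1–3 are the
files `…SwapReflectionPositivityGeometry/Action/ConeData`. [folklore]
-/

noncomputable section

open MeasureTheory
open scoped ComplexConjugate ComplexOrder
open Literature.MathematicalPhysics.QuantumFieldTheory Literature.Probability.LatticeModels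

namespace Summit.QuantumFields.YangMills.Theorems.CurvatureKernel

namespace SwapRP

/-! ## The abstract mechanism on the lattice `ℤ⁴` -/

section Mechanism

variable {G : Type*} [Group G] [TopologicalSpace G] [IsTopologicalGroup G] [CompactSpace G]
  [MeasurableSpace G] [BorelSpace G] {i j : Fin 4}

omit [Group G] [TopologicalSpace G] [IsTopologicalGroup G] [CompactSpace G] [BorelSpace G] in
/-- The reflection `Θ` of configurations is measurable. [folklore] -/
theorem measurable_swapCfg (i j : Fin 4) : Measurable (fun U : ZdGaugeConfig 4 G => (fun e : Site 4
    × Fin 4 => U (e.1 ∘ Equiv.swap i j, Equiv.swap i j e.2))) :=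
  measurable_pi_lambda _ fun _ => measurable_pi_apply _

omit [TopologicalSpace G] [IsTopologicalGroup G] [CompactSpace G] [MeasurableSpace G] [BorelSpace G]
    in
/-- A function of the positive links, read on extended configurations, depends only on the
positive-non-mirror and mirror coordinates (the blocks `P ∪ ∅ ∪ M` of the mechanism). [folklore] -/
theorem dependsOn_comp_ext {E : Finset (Site 4 × Fin 4)} {α : Type*} {g : ZdGaugeConfig 4 G → α}
    (hg : DependsOn g {e : Site 4 × Fin 4 | (e.1 j ≤ e.1 i ∧ (e.1 + Pi.single e.2 (1 : ℤ) : Site 4)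
        j ≤ (e.1 + Pi.single e.2 (1 : ℤ) : Site 4) i)}) :
    DependsOn (fun v : ↥E → G => g ((fun e : Site 4 × Fin 4 => if h : e ∈ E then v ⟨e, h⟩ else (1 :
        G)))) ((((Finset.univ.filter (fun e : ↥E => (e.1.1 j ≤ e.1.1 i ∧ (e.1.1 + Pi.single e.1.2 (1
        : ℤ) : Site 4) j ≤ (e.1.1 + Pi.single e.1.2 (1 : ℤ) : Site 4) i) ∧ ¬ (e.1.1 i = e.1.1 j ∧
        (e.1.1 + Pi.single e.1.2 (1 : ℤ) : Site 4) i = (e.1.1 + Pi.single e.1.2 (1 : ℤ) : Site 4)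
        j))) ∪ ∅ ∪ (Finset.univ.filter (fun e : ↥E => (e.1.1 i = e.1.1 j ∧ (e.1.1 + Pi.single e.1.2
        (1 : ℤ) : Site 4) i = (e.1.1 + Pi.single e.1.2 (1 : ℤ) : Site 4) j)))) : Finset ↥E) : Set
        ↥E) := by
  intro v w hvw
  apply hg
  intro e he
  change (e.1 j ≤ e.1 i ∧ (e.1 + Pi.single e.2 (1 : ℤ) : Site 4) j ≤ (e.1 + Pi.single e.2 (1 : ℤ) :
      Site 4) i) at he
  dsimp only
  by_cases h : e ∈ E
  · rw [dif_pos h, dif_pos h]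
    refine hvw ⟨e, h⟩ (Finset.mem_coe.2 ?_)
    rw [Finset.union_empty, Finset.mem_union]
    by_cases hm : (e.1 i = e.1 j ∧ (e.1 + Pi.single e.2 (1 : ℤ) : Site 4) i = (e.1 + Pi.single e.2
        (1 : ℤ) : Site 4) j)
    · exact Or.inr (Finset.mem_filter.2 ⟨Finset.mem_univ _, hm⟩)
    · exact Or.inl (Finset.mem_filter.2 ⟨Finset.mem_univ _, he, hm⟩)
  · rw [dif_neg h, dif_neg h]

/-- **Abstract reflection positivity on `ℤ⁴` for the diagonal mirror.** For bounded measurable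
`g, aₜ` depending only on positive links and a reflection-symmetric finite set of links `E`,
`0 ≤ ∫ g(U) conj g(ΘU) exp(∑ₜ aₜ(U) conj aₜ(ΘU))` over the finite product Haar measure on `G^E`
(configurations extended by `1` off `E`): the mechanism
`LatticeRP.integral_mul_conj_mul_exp_nonneg_of_shared` with shared block the mirror links, positive
block the positive non-mirror links, and no crossing links. [folklore] -/
theorem integral_mul_conj_mul_exp_nonneg_ext (hij : i ≠ j) {E : Finset (Site 4 × Fin 4)}
    (hE : ∀ e ∈ E, (e.1 ∘ Equiv.swap i j, Equiv.swap i j e.2) ∈ E) {I : Type*} [Fintype I] {g :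
        ZdGaugeConfig 4 G → ℂ}
    {a : I → ZdGaugeConfig 4 G → ℂ} (hgm : Measurable g) (ham : ∀ t, Measurable (a t)) {Kg Ka : ℝ}
    (hgb : ∀ U, ‖g U‖ ≤ Kg) (hab : ∀ t U, ‖a t U‖ ≤ Ka) (hgdep : DependsOn g {e : Site 4 × Fin 4 |
        (e.1 j ≤ e.1 i ∧ (e.1 + Pi.single e.2 (1 : ℤ) : Site 4) j ≤ (e.1 + Pi.single e.2 (1 : ℤ) :
        Site 4) i)})
    (hadep : ∀ t, DependsOn (a t) {e : Site 4 × Fin 4 | (e.1 j ≤ e.1 i ∧ (e.1 + Pi.single e.2 (1 :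
        ℤ) : Site 4) j ≤ (e.1 + Pi.single e.2 (1 : ℤ) : Site 4) i)}) :
    0 ≤ ∫ v, g ((fun e : Site 4 × Fin 4 => if h : e ∈ E then v ⟨e, h⟩ else (1 : G))) * conj (g (fun
        e : Site 4 × Fin 4 => ((fun e : Site 4 × Fin 4 => if h : e ∈ E then v ⟨e, h⟩ else (1 : G)))
        (e.1 ∘ Equiv.swap i j, Equiv.swap i j e.2))) * Complex.exp (∑ t, a t ((fun e : Site 4 × Fin
        4 => if h : e ∈ E then v ⟨e, h⟩ else (1 : G))) * conj (a t (fun e : Site 4 × Fin 4 => ((fun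
        e : Site 4 × Fin 4 => if h : e ∈ E then v ⟨e, h⟩ else (1 : G))) (e.1 ∘ Equiv.swap i j,
        Equiv.swap i j e.2))))
      ∂Measure.pi (fun _ : ↥E => haarProbability G) := by
  set P : Finset ↥E := (Finset.univ.filter (fun e : ↥E => (e.1.1 j ≤ e.1.1 i ∧ (e.1.1 + Pi.single
      e.1.2 (1 : ℤ) : Site 4) j ≤ (e.1.1 + Pi.single e.1.2 (1 : ℤ) : Site 4) i) ∧ ¬ (e.1.1 i = e.1.1
      j ∧ (e.1.1 + Pi.single e.1.2 (1 : ℤ) : Site 4) i = (e.1.1 + Pi.single e.1.2 (1 : ℤ) : Site 4)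
      j))) with hP
  set M : Finset ↥E := (Finset.univ.filter (fun e : ↥E => (e.1.1 i = e.1.1 j ∧ (e.1.1 + Pi.single
      e.1.2 (1 : ℤ) : Site 4) i = (e.1.1 + Pi.single e.1.2 (1 : ℤ) : Site 4) j))) with hM
  have hΘM : ∀ (v : ↥E → G), ∀ e ∈ M, (fun e : ↥E => v ⟨((e.1).1 ∘ Equiv.swap i j, Equiv.swap i j
      (e.1).2), hE e.1 e.2⟩) e = v e := by
    intro v e he
    have he' := (Finset.mem_filter.1 he).2
    show v ⟨_, _⟩ = v e
    congr 1
    exact Subtype.ext (reflEdge_of_mirE hij he')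
  have hΘdep : ∀ e ∈ P ∪ ∅, DependsOn (fun v : ↥E → G => (fun e : ↥E => v ⟨((e.1).1 ∘ Equiv.swap i
      j, Equiv.swap i j (e.1).2), hE e.1 e.2⟩) e) ((Pᶜ : Finset ↥E) : Set ↥E) := by
    intro e he v w hvw
    rw [Finset.union_empty, Finset.mem_filter] at he
    show v ⟨_, _⟩ = w ⟨_, _⟩
    apply hvw
    rw [Finset.mem_coe, Finset.mem_compl, Finset.mem_filter, not_and]
    intro _ hc
    exact not_posE_reflEdge he.2.1 he.2.2 hc.1
  have hMP : Disjoint M P := Finset.disjoint_filter.2 fun e _ hm hp => hp.2 hm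
  have t1 : Measurable (fun v : ↥E → G => g ((fun e : Site 4 × Fin 4 => if h : e ∈ E then v ⟨e, h⟩
      else (1 : G)))) := hgm.comp (measurable_extCfg E)
  have t2 : ∀ t, Measurable (fun v : ↥E → G => a t ((fun e : Site 4 × Fin 4 => if h : e ∈ E then v
      ⟨e, h⟩ else (1 : G)))) := fun t => (ham t).comp (measurable_extCfg E)
  have t3 : ∀ v : ↥E → G, ‖g ((fun e : Site 4 × Fin 4 => if h : e ∈ E then v ⟨e, h⟩ else (1 : G)))‖
      ≤ Kg := fun v => hgb _
  have t4 : ∀ t (v : ↥E → G), ‖a t ((fun e : Site 4 × Fin 4 => if h : e ∈ E then v ⟨e, h⟩ else (1 :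
      G)))‖ ≤ Ka := fun t v => hab t _
  have t5 := dependsOn_comp_ext (E := E) hgdep
  have t6 := fun t => dependsOn_comp_ext (E := E) (hadep t)
  -- hypotheses go through `by exact`: eager unification of the large index terms is slow
  have key := LatticeRP.integral_mul_conj_mul_exp_nonneg_of_shared (haarProbability G) M P (∅ :
      Finset ↥E)
    (fun v : ↥E → G => (fun e : ↥E => v ⟨((e.1).1 ∘ Equiv.swap i j, Equiv.swap i j (e.1).2), hE e.1
        e.2⟩))
    (measurePreserving_swapIdx hE) (by exact hΘM) (by exact hΘdep) (by exact hMP)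
                                                                         (Finset.disjoint_empty_right
                                                                         _)
    (g := fun v : ↥E → G => g ((fun e : Site 4 × Fin 4 => if h : e ∈ E then v ⟨e, h⟩ else (1 : G))))
    (a := fun t (v : ↥E → G) => a t ((fun e : Site 4 × Fin 4 => if h : e ∈ E then v ⟨e, h⟩ else (1 :
        G))))
    (by exact t1) (by exact t2) (by exact t3) (by exact t4) (by exact t5) (by exact t6)
  have hsplice : ∀ p : (↥E → G) × (↥E → G), LatticeRP.splice (∅ : Finset ↥E) p = p.1 :=
    fun p => funext fun e => by simp only [LatticeRP.splice_apply, Finset.notMem_empty, if_false]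
  set Ψ : (↥E → G) → ℂ := fun v => g ((fun e : Site 4 × Fin 4 => if h : e ∈ E then v ⟨e, h⟩ else (1
      : G))) * conj (g (fun e : Site 4 × Fin 4 => ((fun e : Site 4 × Fin 4 => if h : e ∈ E then v
      ⟨e, h⟩ else (1 : G))) (e.1 ∘ Equiv.swap i j, Equiv.swap i j e.2))) *
    Complex.exp (∑ t, a t ((fun e : Site 4 × Fin 4 => if h : e ∈ E then v ⟨e, h⟩ else (1 : G))) *
        conj (a t (fun e : Site 4 × Fin 4 => ((fun e : Site 4 × Fin 4 => if h : e ∈ E then v ⟨e, h⟩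
        else (1 : G))) (e.1 ∘ Equiv.swap i j, Equiv.swap i j e.2)))) with hΨ
  have h1 : ∫ v, Ψ v ∂Measure.pi (fun _ : ↥E => haarProbability G) = ∫ p : (↥E → G) × (↥E → G), Ψ
      p.1
      ∂(Measure.pi (fun _ : ↥E => haarProbability G)).prod (Measure.pi (fun _ : ↥E =>
          haarProbability G)) := by
    rw [integral_fun_fst, probReal_univ, one_smul]
  rw [h1]
  refine key.trans_eq (integral_congr_ae (ae_of_all _ fun p => ?_))
  simp only [hΨ, hsplice, swapCfg_ext hE]

end Mechanism

/-! ## Assembly -/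

section Assembly

variable {G : Type*} [Group G] [TopologicalSpace G] [IsTopologicalGroup G] [CompactSpace G]
  [MeasurableSpace G] [BorelSpace G] [SecondCountableTopology G]
variable {N : ℕ} (ρ : G →* Matrix (Fin N) (Fin N) ℂ) {i j : Fin 4}

/-- **Reflection positivity of the free-boundary Wilson measure for the diagonal mirror
`x i = x j`, `i < j`.** For `β ≥ 0`, a continuous representation `ρ` and a bounded measurable `F`
depending only on links of the closed positive half `x j ≤ x i`, `⟨F · F∘Θ⟩_{Λ_L,β} ≥ 0` on every
cube `Λ_L = {-L,…,L}⁴`. [folklore] -/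
theorem swapReflectionPositivity_of_lt (hρ : Continuous ρ) (hij : i < j) {β : ℝ} (hβ : 0 ≤ β) (L :
    ℕ)
    (F : ZdGaugeConfig 4 G → ℝ) (B : Finset (Site 4 × Fin 4)) (hFm : Measurable F) {C : ℝ}
    (hC : ∀ U, |F U| ≤ C) (hFdep : DependsOn F (B : Set (Site 4 × Fin 4))) (hB : ∀ e ∈ B, (e.1 j ≤
        e.1 i ∧ (e.1 + Pi.single e.2 (1 : ℤ) : Site 4) j ≤ (e.1 + Pi.single e.2 (1 : ℤ) : Site 4)
        i)) :
    0 ≤ zdExpect ρ β (box 4 L) (fun U => F U * F (fun e : Site 4 × Fin 4 => U (e.1 ∘ Equiv.swap i j,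
        Equiv.swap i j e.2))) := by
  set E : Finset (Site 4 × Fin 4) := ((box 4 L ×ˢ (Finset.univ : Finset (Fin 4))).filter (fun e :
      Site 4 × Fin 4 => e.1 + Pi.single e.2 1 ∈ box 4 L)) ∪ (B ∪ B.image (fun e : Site 4 × Fin 4 =>
      (e.1 ∘ Equiv.swap i j, Equiv.swap i j e.2))) with hEdef
  have hE : ∀ e ∈ E, (e.1 ∘ Equiv.swap i j, Equiv.swap i j e.2) ∈ E := fun e he =>
      reflEdge_mem_edgeSet i j he
  have hHdep : DependsOn (fun U : ZdGaugeConfig 4 G =>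
      (((F U * F (fun e : Site 4 × Fin 4 => U (e.1 ∘ Equiv.swap i j, Equiv.swap i j e.2))) *
          Real.exp (-β * zdWilsonAction ρ (box 4 L) U) : ℝ) : ℂ)) (E : Set (Site 4 × Fin 4)) := by
    intro U V hUV
    have h1 : F U = F V := hFdep fun e he =>
      hUV e (Finset.mem_coe.2 (Finset.mem_union_right _ (Finset.mem_union_left _ (Finset.mem_coe.1
          he))))
    have h2 : F (fun e : Site 4 × Fin 4 => U (e.1 ∘ Equiv.swap i j, Equiv.swap i j e.2)) = F (fun e
        : Site 4 × Fin 4 => V (e.1 ∘ Equiv.swap i j, Equiv.swap i j e.2)) := dependsOn_comp_swapCfg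
        i j hFdep fun e he =>
      hUV e (Finset.mem_coe.2 (Finset.mem_union_right _ (Finset.mem_union_right _ (Finset.mem_coe.1
          he))))
    have h3 : zdWilsonAction ρ (box 4 L) U = zdWilsonAction ρ (box 4 L) V :=
      dependsOn_zdWilsonAction_box ρ L fun e he =>
        hUV e (Finset.mem_coe.2 (Finset.mem_union_left _ (Finset.mem_coe.1 he)))
    simp only [h1, h2, h3]
  have hHm : Measurable (fun U : ZdGaugeConfig 4 G =>
      (((F U * F (fun e : Site 4 × Fin 4 => U (e.1 ∘ Equiv.swap i j, Equiv.swap i j e.2))) *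
          Real.exp (-β * zdWilsonAction ρ (box 4 L) U) : ℝ) : ℂ)) :=
    Complex.measurable_ofReal.comp ((hFm.mul (hFm.comp (measurable_swapCfg i j))).mul
      (((AreaLaw.continuous_zdWilsonAction ρ hρ (box 4 L)).measurable.const_mul (-β)).exp))
  have hnum : (0 : ℂ) ≤
      ∫ U, (((F U * F (fun e : Site 4 × Fin 4 => U (e.1 ∘ Equiv.swap i j, Equiv.swap i j e.2))) *
          Real.exp (-β * zdWilsonAction ρ (box 4 L) U) : ℝ) : ℂ) ∂zdHaar 4 G := by
    rw [integral_zdHaar_eq_integral_pi _ hHm hHdep]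
    calc (0 : ℂ) ≤ (Real.exp (-β * ((N : ℝ) * (plaquettesIn (box 4 L)).card)) : ℂ) *
          ∫ v, ((F ((fun e : Site 4 × Fin 4 => if h : e ∈ E then v ⟨e, h⟩ else (1 : G))) : ℂ) *
              (Real.exp (β * (∑ p ∈ (plaquettesIn (box 4 L)).filter (fun p : Site 4 × Fin 4 × Fin 4
              => ((p.1 j ≤ p.1 i ∧ (p.1 + Pi.single p.2.1 1 : Site 4) j ≤ (p.1 + Pi.single p.2.1 1 :
              Site 4) i ∧ (p.1 + Pi.single p.2.2 1 : Site 4) j ≤ (p.1 + Pi.single p.2.2 1 : Site 4)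
              i ∧ (p.1 + Pi.single p.2.1 1 + Pi.single p.2.2 1 : Site 4) j ≤ (p.1 + Pi.single p.2.1
              1 + Pi.single p.2.2 1 : Site 4) i) ∧ ¬ (p.1 i = p.1 j ∧ (p.1 + Pi.single p.2.1 1 :
              Site 4) i = (p.1 + Pi.single p.2.1 1 : Site 4) j ∧ (p.1 + Pi.single p.2.2 1 : Site 4)
              i = (p.1 + Pi.single p.2.2 1 : Site 4) j))), (ρ (ZdGaugeConfig.plaquette ((fun e :
              Site 4 × Fin 4 => if h : e ∈ E then v ⟨e, h⟩ else (1 : G))) p.1 p.2.1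
              p.2.2)).trace.re) + β / 2 * (∑ p ∈ (plaquettesIn (box 4 L)).filter (fun p : Site 4 ×
              Fin 4 × Fin 4 => (p.1 i = p.1 j ∧ (p.1 + Pi.single p.2.1 1 : Site 4) i = (p.1 +
              Pi.single p.2.1 1 : Site 4) j ∧ (p.1 + Pi.single p.2.2 1 : Site 4) i = (p.1 +
              Pi.single p.2.2 1 : Site 4) j)), (ρ (ZdGaugeConfig.plaquette ((fun e : Site 4 × Fin 4
              => if h : e ∈ E then v ⟨e, h⟩ else (1 : G))) p.1 p.2.1 p.2.2)).trace.re)) : ℂ)) * conj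
              (((F ((fun e : Site 4 × Fin 4 => ((fun e : Site 4 × Fin 4 => if h : e ∈ E then v ⟨e,
              h⟩ else (1 : G))) (e.1 ∘ Equiv.swap i j, Equiv.swap i j e.2))) : ℂ) * (Real.exp (β *
              (∑ p ∈ (plaquettesIn (box 4 L)).filter (fun p : Site 4 × Fin 4 × Fin 4 => ((p.1 j ≤
              p.1 i ∧ (p.1 + Pi.single p.2.1 1 : Site 4) j ≤ (p.1 + Pi.single p.2.1 1 : Site 4) i ∧
              (p.1 + Pi.single p.2.2 1 : Site 4) j ≤ (p.1 + Pi.single p.2.2 1 : Site 4) i ∧ (p.1 +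
              Pi.single p.2.1 1 + Pi.single p.2.2 1 : Site 4) j ≤ (p.1 + Pi.single p.2.1 1 +
              Pi.single p.2.2 1 : Site 4) i) ∧ ¬ (p.1 i = p.1 j ∧ (p.1 + Pi.single p.2.1 1 : Site 4)
              i = (p.1 + Pi.single p.2.1 1 : Site 4) j ∧ (p.1 + Pi.single p.2.2 1 : Site 4) i = (p.1
              + Pi.single p.2.2 1 : Site 4) j))), (ρ (ZdGaugeConfig.plaquette ((fun e : Site 4 × Fin
              4 => ((fun e : Site 4 × Fin 4 => if h : e ∈ E then v ⟨e, h⟩ else (1 : G))) (e.1 ∘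
              Equiv.swap i j, Equiv.swap i j e.2))) p.1 p.2.1 p.2.2)).trace.re) + β / 2 * (∑ p ∈
              (plaquettesIn (box 4 L)).filter (fun p : Site 4 × Fin 4 × Fin 4 => (p.1 i = p.1 j ∧
              (p.1 + Pi.single p.2.1 1 : Site 4) i = (p.1 + Pi.single p.2.1 1 : Site 4) j ∧ (p.1 +
              Pi.single p.2.2 1 : Site 4) i = (p.1 + Pi.single p.2.2 1 : Site 4) j)), (ρ
              (ZdGaugeConfig.plaquette ((fun e : Site 4 × Fin 4 => ((fun e : Site 4 × Fin 4 => if h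
              : e ∈ E then v ⟨e, h⟩ else (1 : G))) (e.1 ∘ Equiv.swap i j, Equiv.swap i j e.2))) p.1
              p.2.1 p.2.2)).trace.re)) : ℂ))) *
            Complex.exp (∑ idx : (↥((plaquettesIn (box 4 L)).filter (fun p : Site 4 × Fin 4 × Fin 4
                => (p.2.1 = i ∧ p.2.2 = j ∧ p.1 i = p.1 j))) × Fin N × Fin N × Bool), ((Real.sqrt (β
                / 2) : ℂ) * (if idx.2.2.2 then
                Literature.RepresentationTheory.CompactGroups.CompactGroup.unitarize ρ hρ (((fun e :
                Site 4 × Fin 4 => if h : e ∈ E then v ⟨e, h⟩ else (1 : G))) (idx.1.1.1, i) * ((fun e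
                : Site 4 × Fin 4 => if h : e ∈ E then v ⟨e, h⟩ else (1 : G))) (idx.1.1.1 + Pi.single
                i 1, j)) idx.2.1 idx.2.2.1 else conj
                (Literature.RepresentationTheory.CompactGroups.CompactGroup.unitarize ρ hρ (((fun e
                : Site 4 × Fin 4 => if h : e ∈ E then v ⟨e, h⟩ else (1 : G))) (idx.1.1.1, i) * ((fun
                e : Site 4 × Fin 4 => if h : e ∈ E then v ⟨e, h⟩ else (1 : G))) (idx.1.1.1 +
                Pi.single i 1, j)) idx.2.1 idx.2.2.1))) * conj (((Real.sqrt (β / 2) : ℂ) * (if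
                idx.2.2.2 then Literature.RepresentationTheory.CompactGroups.CompactGroup.unitarize
                ρ hρ (((fun e : Site 4 × Fin 4 => ((fun e : Site 4 × Fin 4 => if h : e ∈ E then v
                ⟨e, h⟩ else (1 : G))) (e.1 ∘ Equiv.swap i j, Equiv.swap i j e.2))) (idx.1.1.1, i) *
                ((fun e : Site 4 × Fin 4 => ((fun e : Site 4 × Fin 4 => if h : e ∈ E then v ⟨e, h⟩
                else (1 : G))) (e.1 ∘ Equiv.swap i j, Equiv.swap i j e.2))) (idx.1.1.1 + Pi.single i
                1, j)) idx.2.1 idx.2.2.1 else conj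
                (Literature.RepresentationTheory.CompactGroups.CompactGroup.unitarize ρ hρ (((fun e
                : Site 4 × Fin 4 => ((fun e : Site 4 × Fin 4 => if h : e ∈ E then v ⟨e, h⟩ else (1 :
                G))) (e.1 ∘ Equiv.swap i j, Equiv.swap i j e.2))) (idx.1.1.1, i) * ((fun e : Site 4
                × Fin 4 => ((fun e : Site 4 × Fin 4 => if h : e ∈ E then v ⟨e, h⟩ else (1 : G)))
                (e.1 ∘ Equiv.swap i j, Equiv.swap i j e.2))) (idx.1.1.1 + Pi.single i 1, j)) idx.2.1
                idx.2.2.1)))))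
          ∂Measure.pi (fun _ : ↥E => haarProbability G) :=
        mul_nonneg (Complex.zero_le_real.2 (Real.exp_pos _).le)
          (integral_mul_conj_mul_exp_nonneg_ext hij.ne hE (g := fun V : ZdGaugeConfig 4 G => ((F V :
              ℂ) * (Real.exp (β * (∑ p ∈ (plaquettesIn (box 4 L)).filter (fun p : Site 4 × Fin 4 ×
              Fin 4 => ((p.1 j ≤ p.1 i ∧ (p.1 + Pi.single p.2.1 1 : Site 4) j ≤ (p.1 + Pi.single
              p.2.1 1 : Site 4) i ∧ (p.1 + Pi.single p.2.2 1 : Site 4) j ≤ (p.1 + Pi.single p.2.2 1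
              : Site 4) i ∧ (p.1 + Pi.single p.2.1 1 + Pi.single p.2.2 1 : Site 4) j ≤ (p.1 +
              Pi.single p.2.1 1 + Pi.single p.2.2 1 : Site 4) i) ∧ ¬ (p.1 i = p.1 j ∧ (p.1 +
              Pi.single p.2.1 1 : Site 4) i = (p.1 + Pi.single p.2.1 1 : Site 4) j ∧ (p.1 +
              Pi.single p.2.2 1 : Site 4) i = (p.1 + Pi.single p.2.2 1 : Site 4) j))), (ρ
              (ZdGaugeConfig.plaquette V p.1 p.2.1 p.2.2)).trace.re) + β / 2 * (∑ p ∈ (plaquettesIn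
              (box 4 L)).filter (fun p : Site 4 × Fin 4 × Fin 4 => (p.1 i = p.1 j ∧ (p.1 + Pi.single
              p.2.1 1 : Site 4) i = (p.1 + Pi.single p.2.1 1 : Site 4) j ∧ (p.1 + Pi.single p.2.2 1
              : Site 4) i = (p.1 + Pi.single p.2.2 1 : Site 4) j)), (ρ (ZdGaugeConfig.plaquette V
              p.1 p.2.1 p.2.2)).trace.re)) : ℂ)))
            (a := fun (idx : (↥((plaquettesIn (box 4 L)).filter (fun p : Site 4 × Fin 4 × Fin 4 =>
                (p.2.1 = i ∧ p.2.2 = j ∧ p.1 i = p.1 j))) × Fin N × Fin N × Bool)) (V :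
                ZdGaugeConfig 4 G) => ((Real.sqrt (β / 2) : ℂ) * (if idx.2.2.2 then
                Literature.RepresentationTheory.CompactGroups.CompactGroup.unitarize ρ hρ (V
                (idx.1.1.1, i) * V (idx.1.1.1 + Pi.single i 1, j)) idx.2.1 idx.2.2.1 else conj
                (Literature.RepresentationTheory.CompactGroups.CompactGroup.unitarize ρ hρ (V
                (idx.1.1.1, i) * V (idx.1.1.1 + Pi.single i 1, j)) idx.2.1 idx.2.2.1))))
            (by exact measurable_gobs ρ hρ β L hFm) (by exact fun idx => measurable_acoef ρ hρ β L
                                                          idx)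
            (by exact norm_gobs_le ρ hρ β L hC) (by exact fun idx V => norm_acoef_le ρ hρ β L idx V)
            (by exact dependsOn_gobs ρ β L hFdep hB) (by exact fun idx => dependsOn_acoef ρ hij.ne
                                                           hρ β L idx))
      _ = _ := by
        rw [← integral_const_mul]
        exact integral_congr_ae (ae_of_all _ fun v => (integrand_eq ρ hij hρ hβ L F ((fun e : Site 4
            × Fin 4 => if h : e ∈ E then v ⟨e, h⟩ else (1 : G)))).symm)
  rw [AreaLaw.zdExpect_eq_div_integral ρ hρ β (box 4 L)]
  refine div_nonneg ?_ (integral_nonneg fun U => (Real.exp_pos _).le)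
  rw [← Complex.zero_le_real, ← integral_complex_ofReal]
  exact hnum

end Assembly

end SwapRP

/-- **Reflection positivity of the free-boundary Wilson lattice gauge measure on the cube
`{-L,…,L}⁴` for the diagonal site mirror `x i = x j`** (Fröhlich–Israel–Lieb–Simon, Comm. Math.
Phys. 62 (1978) 1, Thm. 2.1, reflection through sites; Osterwalder–Seiler, Ann. Phys. 110 (1978)
440, §2). For a compact group `G`, a continuous unitary matrix representation `ρ`, `β ≥ 0`, and a
bounded measurable observable `F` depending only on links with both endpoints in the closed half
`x j ≤ x i`, `⟨F · (F ∘ Θ)⟩_{Λ_L,β} ≥ 0`, where `(ΘU)(x, k) = U(x ∘ swap i j, swap i j k)`.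
Proof: the plaquettes of the box lie in one closed half, inside the mirror, or (the
`(i, j)`-plaquettes based on the mirror) are cut by it with holonomy `V₊ V₊(ΘU)⁻¹`, whose character
is a Gram kernel in the unitarised representation; the Boltzmann weight is thus of the cone form
`g(U) conj g(ΘU) exp(∑ a(U) conj a(ΘU))` and the abstract mechanism with shared block (the links in
the mirror) applies on the finite product of Haar measures over the links involved, to which the
`dg_∞`-integral reduces. The case `j < i` follows from `i < j` applied to `F ∘ Θ`.
(REGISTERED signature.) [folklore] -/
theorem SwapReflectionPositivity : ∀ {G : Type*} [Group G] [TopologicalSpace G] [IsTopologicalGroup G] [CompactSpace G] [T2Space G] [SecondCountableTopology G] [MeasurableSpace G] [BorelSpace G] {N : ℕ} (ρ : G →* Matrix (Fin N) (Fin N) ℂ), Continuous ρ → (∀ g, ρ g ∈ Matrix.unitaryGroup (Fin N) ℂ) → ∀ (i j : Fin 4), i ≠ j → ∀ (β : ℝ), 0 ≤ β → ∀ (L : ℕ) (F : Literature.MathematicalPhysics.QuantumFieldTheory.ZdGaugeConfig 4 G → ℝ) (B : Finset (Literature.MathematicalPhysics.QuantumLattice.ZdEdge 4)), Measurable F → (∃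 C : ℝ, ∀ U, |F U| ≤ C) → DependsOn F (B : Set (Literature.MathematicalPhysics.QuantumLattice.ZdEdge 4)) → (∀ e ∈ B, e.1 j ≤ e.1 i ∧ (e.1 + Pi.single e.2 (1 : ℤ) : Literature.Probability.LatticeModels.Site 4) j ≤ (e.1 + Pi.single e.2 (1 : ℤ) : Literature.Probability.LatticeModels.Site 4) i) → 0 ≤ Literature.MathematicalPhysics.QuantumFieldTheory.zdExpect ρ β (Literature.Probability.LatticeModels.box 4 L) (fun U => F U * F (fun e : Literature.MathematicalPhysics.QuantumLattice.ZdEdge 4 => U (e.1 ∘ Equiv.swap i j, Equiv.swap i j e.2))) := by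
  intro G _ _ _ _ _ _ _ _ N ρ hρ _ i j hij β hβ L F B hFm hFb hFdep hB
  obtain ⟨C, hC⟩ := hFb
  rcases lt_or_gt_of_ne hij with h | h
  · exact SwapRP.swapReflectionPositivity_of_lt ρ hρ h hβ L F B hFm hC hFdep hB
  · have hB' : ∀ e ∈ B.image (fun e : Site 4 × Fin 4 => (e.1 ∘ Equiv.swap i j, Equiv.swap i j e.2)),
        e.1 i ≤ e.1 j ∧ (e.1 + Pi.single e.2 (1 : ℤ) : Site 4) i ≤ (e.1 + Pi.single e.2 (1 : ℤ) :
            Site 4) j := by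
      intro e he
      obtain ⟨b, hb, rfl⟩ := Finset.mem_image.1 he
      have h' := hB b hb
      simp only [Function.comp_apply, Pi.add_apply, Equiv.swap_apply_left, Equiv.swap_apply_right,
        SwapRP.single_swap_apply_left, SwapRP.single_swap_apply_right] at h' ⊢
      omega
    have key := SwapRP.swapReflectionPositivity_of_lt ρ hρ h hβ L (fun U => F (fun e : Site 4 × Fin
        4 => U (e.1 ∘ Equiv.swap i j, Equiv.swap i j e.2)))
      (B.image (fun e : Site 4 × Fin 4 => (e.1 ∘ Equiv.swap i j, Equiv.swap i j e.2))) (hFm.comp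
          (SwapRP.measurable_swapCfg i j))
      (fun U => hC _) (SwapRP.dependsOn_comp_swapCfg i j hFdep) hB'
    convert key using 2
    funext U
    simp only [Equiv.swap_comm j i, SwapRP.swapSite_swapSite, Equiv.swap_apply_self, Prod.mk.eta]
    ring

end Summit.QuantumFields.YangMills.Theorems.CurvatureKernel

end
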